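import Mathlib
import HarnessLib
import Literature.Analysis.Fourier.FejerJacksonKernels

/-!
# The de la Vallée-Poussin kernel `V_m = 2F_{2m+1} − F_m`: unit mass, `L¹` norm at most `3`, and the multiplier
# weights (Fourier–cosine moments) of the Fejér and de la Vallée-Poussin kernels

Topic `Literature/Analysis/Fourier`; continues `FejerJacksonKernels.lean` (the Fejér kernel
`F_M(x) = |Σ_{j≤M} e(jx)|²/(M+1) = 1 + (2/(M+1)) Σ_{h=1}^{M} (M+1−h) cos(2πhx)`, period `1`, `∫₀¹ F_M = 1`,
`F_M ≥ 0`).  The de la Vallée-Poussin kernel [Zygmund, *Trigonometric Series*, Ch. III §13; DeVore–Lorentz,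
*Constructive Approximation*, Ch. 9 §3] is the difference `V_m := 2·F_{2m+1} − F_m`; its Fourier multiplier is
`1` on the frequencies `|h| ≤ m + 1` and decays linearly to `0` at `|h| = 2m + 2`, so convolution with `V_m`
REPRODUCES trigonometric polynomials of degree `≤ m + 1` [Katznelson2004, I.2], while — being a difference of two positive kernels
of unit mass — it has `∫₀¹ V_m = 1` and `∫₀¹ |V_m| ≤ 3`.  Hence the de la Vallée-Poussin means are uniformly bounded on `C`
and on every `C^k` (norm `≤ 3` per variable) — unlike partial sums or interpolation (Lebesgue constants `≍ log n`,
Kharshiladze–Lozinski) — which is what makes them the smoothing of choice when derivative bounds must survive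
uniformly in the degree.

* §1 cosine orthogonality on `[0,1]` and the **multiplier weights of the Fejér kernel**:
  `∫₀¹ F_M(x) cos(2πhx) dx = 1 − h/(M+1)` for `1 ≤ h ≤ M`, `= 0` for `h > M` (`integral_fejer_mul_cos_of_le/_of_lt`);
* §2 `vp m := 2 F_{2m+1} − F_m`: continuity, evenness, `1`-periodicity, `integral_vp = 1`, `|V_m| ≤ 2F_{2m+1} + F_m`,
  **`integral_abs_vp_le : ∫₀¹ |V_m| ≤ 3`**, and the **weights** `∫₀¹ V_m cos(2πh·) = 1` for `1 ≤ h ≤ m+1`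
  (`integral_vp_mul_cos_of_le`), `= 2 − h/(m+1)` for `m+1 ≤ h ≤ 2m+1`, `= 0` for `h > 2m+1`.

Everything is proved; no named facts. [folklore]

## References
* G. Travaglini, *Number Theory, Fourier Analysis and Geometric Discrepancy*, CUP 2014, §7.1 (`Travaglini2014`).
* Y. Katznelson, *An Introduction to Harmonic Analysis*, I.2 (Fejér and de la Vallée-Poussin kernels) (`Katznelson2004`).
* A. Zygmund, *Trigonometric Series*, Vol. I, Ch. III §13 (delayed means); R. A. DeVore, G. G. Lorentz, *Constructive Approximation*, Ch. 9 §3.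
-/

noncomputable section

open Real Finset MeasureTheory intervalIntegral

namespace Literature.Analysis.Fourier.TrigApprox

/-! ## §1 Cosine orthogonality on `[0, 1]` and the multiplier weights of the Fejér kernel -/

/-- `∫₀¹ cos(2πhx) cos(2πkx) dx = 0` for natural `h ≠ k` (not both zero is automatic). [cite: Katznelson2004, I.1.5] -/
theorem integral_cos_mul_cos_of_ne {h k : ℕ} (hne : h ≠ k) :
    ∫ x in (0 : ℝ)..1, Real.cos (2 * π * h * x) * Real.cos (2 * π * k * x) = 0 := by
  have hprod : ∀ x : ℝ, Real.cos (2 * π * h * x) * Real.cos (2 * π * k * x) =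
      (Real.cos (2 * π * ((h : ℝ) + k) * x) + Real.cos (2 * π * ((h : ℝ) - k) * x)) / 2 := by
    intro x
    rw [show 2 * π * ((h : ℝ) + k) * x = 2 * π * h * x + 2 * π * k * x by ring,
      show 2 * π * ((h : ℝ) - k) * x = 2 * π * h * x - 2 * π * k * x by ring, Real.cos_add, Real.cos_sub]
    ring
  simp_rw [hprod]
  rw [intervalIntegral.integral_div, intervalIntegral.integral_add (Continuous.intervalIntegrable (by fun_prop) _ _)
    (Continuous.intervalIntegrable (by fun_prop) _ _)]
  -- the sum frequency `h + k ≥ 1`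
  have hsum : ∫ x in (0 : ℝ)..1, Real.cos (2 * π * ((h : ℝ) + k) * x) = 0 := by
    have h1 : 1 ≤ h + k := by omega
    have := integral_cos_two_pi_mul_nat h1
    push_cast at this
    exact this
  -- the difference frequency `h - k ≠ 0` (an integer of either sign)
  have hdiff : ∫ x in (0 : ℝ)..1, Real.cos (2 * π * ((h : ℝ) - k) * x) = 0 := by
    rcases lt_or_gt_of_ne hne with hlt | hgt
    · have h1 : 1 ≤ k - h := by omega
      have := integral_cos_two_pi_mul_nat h1
      rw [Nat.cast_sub hlt.le] at this
      have e : ∀ x : ℝ, Real.cos (2 * π * ((h : ℝ) - k) * x) = Real.cos (2 * π * ((k : ℝ) - h) * x) := by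
        intro x; rw [← Real.cos_neg]; ring_nf
      simp_rw [e]
      exact this
    · have h1 : 1 ≤ h - k := by omega
      have := integral_cos_two_pi_mul_nat h1
      rw [Nat.cast_sub hgt.le] at this
      exact this
  rw [hsum, hdiff]
  norm_num

/-- `∫₀¹ cos²(2πhx) dx = 1/2` for `h ≥ 1`. [cite: Katznelson2004, I.1.5] -/
theorem integral_cos_sq_two_pi_mul_nat {h : ℕ} (hh : 1 ≤ h) :
    ∫ x in (0 : ℝ)..1, Real.cos (2 * π * h * x) * Real.cos (2 * π * h * x) = 1 / 2 := by
  have hprod : ∀ x : ℝ, Real.cos (2 * π * h * x) * Real.cos (2 * π * h * x) =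
      (Real.cos (2 * π * ((2 * h : ℕ) : ℝ) * x) + 1) / 2 := by
    intro x
    rw [show 2 * π * ((2 * h : ℕ) : ℝ) * x = 2 * (2 * π * h * x) by push_cast; ring, Real.cos_two_mul]
    ring
  simp_rw [hprod]
  rw [intervalIntegral.integral_div, intervalIntegral.integral_add (Continuous.intervalIntegrable (by fun_prop) _ _)
    intervalIntegrable_const, integral_cos_two_pi_mul_nat (by omega : 1 ≤ 2 * h)]
  simp

/-- **Multiplier weights of the Fejér kernel, in the band**: `∫₀¹ F_M(x) cos(2πhx) dx = 1 − h/(M+1)` for `1 ≤ h ≤ M`. [cite: Travaglini2014, §7.1 (7.4)] -/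
theorem integral_fejer_mul_cos_of_le (M : ℕ) {h : ℕ} (h1 : 1 ≤ h) (hM : h ≤ M) :
    ∫ x in (0 : ℝ)..1, fejer M x * Real.cos (2 * π * h * x) = 1 - h / (M + 1) := by
  have hMpos : (0 : ℝ) < M + 1 := by positivity
  have hexp : ∀ x : ℝ, fejer M x * Real.cos (2 * π * h * x) =
      Real.cos (2 * π * h * x) + 2 / (M + 1) * ∑ k ∈ Finset.Icc 1 M,
        ((M + 1 : ℝ) - k) * (Real.cos (2 * π * k * x) * Real.cos (2 * π * h * x)) := by
    intro x
    rw [fejer_eq]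
    have e3 : ∀ a S c : ℝ, (1 + a * S) * c = c + a * (S * c) := by intros; ring
    rw [e3, Finset.sum_mul]
    congr 2
    exact Finset.sum_congr rfl fun k _ => by ring
  simp_rw [hexp]
  rw [intervalIntegral.integral_add (Continuous.intervalIntegrable (by fun_prop) _ _) ?_, integral_cos_two_pi_mul_nat h1, zero_add,
    intervalIntegral.integral_const_mul, intervalIntegral.integral_finsetSum]
  · -- only the term `k = h` survives
    rw [Finset.sum_eq_single h]
    · rw [intervalIntegral.integral_const_mul, integral_cos_sq_two_pi_mul_nat h1]
      field_simp
    · intro k _ hk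
      rw [intervalIntegral.integral_const_mul, integral_cos_mul_cos_of_ne hk, mul_zero]
    · intro hh
      exact absurd (Finset.mem_Icc.mpr ⟨h1, hM⟩) hh
  · intro k _
    exact Continuous.intervalIntegrable (by fun_prop) _ _
  · exact Continuous.intervalIntegrable
      (continuous_const.mul (continuous_finsetSum _ fun k _ => by fun_prop)) _ _

/-- **Multiplier weights of the Fejér kernel, above the band**: `∫₀¹ F_M(x) cos(2πhx) dx = 0` for `h > M`. [cite: Travaglini2014, §7.1 (7.4)] -/
theorem integral_fejer_mul_cos_of_lt (M : ℕ) {h : ℕ} (hM : M < h) :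
    ∫ x in (0 : ℝ)..1, fejer M x * Real.cos (2 * π * h * x) = 0 := by
  have h1 : 1 ≤ h := by omega
  have hexp : ∀ x : ℝ, fejer M x * Real.cos (2 * π * h * x) =
      Real.cos (2 * π * h * x) + 2 / (M + 1) * ∑ k ∈ Finset.Icc 1 M,
        ((M + 1 : ℝ) - k) * (Real.cos (2 * π * k * x) * Real.cos (2 * π * h * x)) := by
    intro x
    rw [fejer_eq]
    have e3 : ∀ a S c : ℝ, (1 + a * S) * c = c + a * (S * c) := by intros; ring
    rw [e3, Finset.sum_mul]
    congr 2
    exact Finset.sum_congr rfl fun k _ => by ring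
  simp_rw [hexp]
  rw [intervalIntegral.integral_add (Continuous.intervalIntegrable (by fun_prop) _ _) ?_, integral_cos_two_pi_mul_nat h1, zero_add,
    intervalIntegral.integral_const_mul, intervalIntegral.integral_finsetSum]
  · rw [Finset.sum_eq_zero, mul_zero]
    intro k hk
    have hne : k ≠ h := by have := (Finset.mem_Icc.mp hk).2; omega
    rw [intervalIntegral.integral_const_mul, integral_cos_mul_cos_of_ne hne, mul_zero]
  · intro k _
    exact Continuous.intervalIntegrable (by fun_prop) _ _
  · exact Continuous.intervalIntegrable
      (continuous_const.mul (continuous_finsetSum _ fun k _ => by fun_prop)) _ _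

/-! ## §2 The de la Vallée-Poussin kernel -/

/-- **The de la Vallée-Poussin kernel** `V_m := 2·F_{2m+1} − F_m` (period `1`). [cite: Katznelson2004, I.2.13] -/
def vp (m : ℕ) (x : ℝ) : ℝ := 2 * fejer (2 * m + 1) x - fejer m x

/-- `V_m` is continuous. [cite: Katznelson2004, I.2.13] -/
theorem continuous_vp (m : ℕ) : Continuous (vp m) := by
  show Continuous fun x => 2 * fejer (2 * m + 1) x - fejer m x
  exact (continuous_const.mul (continuous_fejer _)).sub (continuous_fejer _)

/-- `V_m` is even. [cite: Katznelson2004, I.2.13] -/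
theorem vp_neg (m : ℕ) (x : ℝ) : vp m (-x) = vp m x := by
  simp [vp, fejer_neg]

/-- `V_m` is `1`-periodic. [cite: Katznelson2004, I.2.13] -/
theorem vp_add_int (m : ℕ) (x : ℝ) (k : ℤ) : vp m (x + k) = vp m x := by
  simp [vp, fejer_add_int]

/-- `|V_m| ≤ 2F_{2m+1} + F_m` (a difference of two nonnegative kernels). [cite: Katznelson2004, I.2.13] -/
theorem abs_vp_le (m : ℕ) (x : ℝ) : |vp m x| ≤ 2 * fejer (2 * m + 1) x + fejer m x := by
  have h1 := fejer_nonneg (2 * m + 1) x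
  have h2 := fejer_nonneg m x
  rw [vp, abs_le]
  constructor <;> linarith

/-- **Unit mass**: `∫₀¹ V_m = 1`. [cite: Katznelson2004, I.2.13] -/
theorem integral_vp (m : ℕ) : ∫ x in (0 : ℝ)..1, vp m x = 1 := by
  unfold vp
  rw [intervalIntegral.integral_sub ((continuous_fejer _).intervalIntegrable _ _ |>.const_mul 2)
    ((continuous_fejer _).intervalIntegrable _ _), intervalIntegral.integral_const_mul, integral_fejer, integral_fejer]
  norm_num

/-- **`L¹` bound**: `∫₀¹ |V_m| ≤ 3` — UNIFORM in `m` (this is what makes de la Vallée-Poussin means bounded on `C` and on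
every `C^k` uniformly in the degree). [cite: Katznelson2004, I.2.13] -/
theorem integral_abs_vp_le (m : ℕ) : ∫ x in (0 : ℝ)..1, |vp m x| ≤ 3 := by
  have hint : IntervalIntegrable (fun x => |vp m x|) volume 0 1 := (continuous_vp m).abs.intervalIntegrable _ _
  have hint2 : IntervalIntegrable (fun x => 2 * fejer (2 * m + 1) x + fejer m x) volume 0 1 :=
    ((continuous_const.mul (continuous_fejer (2 * m + 1))).add (continuous_fejer m)).intervalIntegrable _ _
  calc ∫ x in (0 : ℝ)..1, |vp m x| ≤ ∫ x in (0 : ℝ)..1, (2 * fejer (2 * m + 1) x + fejer m x) :=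
        intervalIntegral.integral_mono_on zero_le_one hint hint2 fun x _ => abs_vp_le m x
    _ = 3 := by
        rw [intervalIntegral.integral_add ((continuous_fejer _).intervalIntegrable _ _ |>.const_mul 2)
          ((continuous_fejer _).intervalIntegrable _ _), intervalIntegral.integral_const_mul, integral_fejer, integral_fejer]
        norm_num

/-- **The weights in the band**: `∫₀¹ V_m(x) cos(2πhx) dx = 1` for `1 ≤ h ≤ m + 1` — convolution with `V_m` reproduces
every trigonometric polynomial of degree `≤ m + 1`. [cite: Katznelson2004, I.2.13] -/
theorem integral_vp_mul_cos_of_le (m : ℕ) {h : ℕ} (h1 : 1 ≤ h) (hm : h ≤ m + 1) :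
    ∫ x in (0 : ℝ)..1, vp m x * Real.cos (2 * π * h * x) = 1 := by
  have hexp : ∀ x : ℝ, vp m x * Real.cos (2 * π * h * x) =
      2 * (fejer (2 * m + 1) x * Real.cos (2 * π * h * x)) - fejer m x * Real.cos (2 * π * h * x) := by
    intro x; rw [vp]; ring
  simp_rw [hexp]
  have hi1 : IntervalIntegrable (fun x => fejer (2 * m + 1) x * Real.cos (2 * π * h * x)) volume 0 1 :=
    ((continuous_fejer _).mul (by fun_prop)).intervalIntegrable _ _
  have hi2 : IntervalIntegrable (fun x => fejer m x * Real.cos (2 * π * h * x)) volume 0 1 :=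
    ((continuous_fejer _).mul (by fun_prop)).intervalIntegrable _ _
  rw [intervalIntegral.integral_sub (hi1.const_mul 2) hi2, intervalIntegral.integral_const_mul,
    integral_fejer_mul_cos_of_le (2 * m + 1) h1 (by omega)]
  rcases Nat.lt_or_ge m h with hlt | hge
  · -- `h = m + 1`: the second integral vanishes, the first weight is `1 − (m+1)/(2m+2) = 1/2`
    rw [integral_fejer_mul_cos_of_lt m hlt]
    have hh : h = m + 1 := le_antisymm hm hlt
    subst hh
    push_cast
    field_simp
    ring
  · rw [integral_fejer_mul_cos_of_le m h1 hge]
    push_cast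
    field_simp
    ring

/-- **The weights in the transition band**: `∫₀¹ V_m(x) cos(2πhx) dx = 2 − h/(m+1)` for `m + 1 ≤ h ≤ 2m + 1`. [cite: Katznelson2004, I.2.13] -/
theorem integral_vp_mul_cos_of_mem (m : ℕ) {h : ℕ} (hlo : m + 1 ≤ h) (hhi : h ≤ 2 * m + 1) :
    ∫ x in (0 : ℝ)..1, vp m x * Real.cos (2 * π * h * x) = 2 - h / (m + 1) := by
  have h1 : 1 ≤ h := by omega
  have hexp : ∀ x : ℝ, vp m x * Real.cos (2 * π * h * x) =
      2 * (fejer (2 * m + 1) x * Real.cos (2 * π * h * x)) - fejer m x * Real.cos (2 * π * h * x) := by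
    intro x; rw [vp]; ring
  simp_rw [hexp]
  have hi1 : IntervalIntegrable (fun x => fejer (2 * m + 1) x * Real.cos (2 * π * h * x)) volume 0 1 :=
    ((continuous_fejer _).mul (by fun_prop)).intervalIntegrable _ _
  have hi2 : IntervalIntegrable (fun x => fejer m x * Real.cos (2 * π * h * x)) volume 0 1 :=
    ((continuous_fejer _).mul (by fun_prop)).intervalIntegrable _ _
  rw [intervalIntegral.integral_sub (hi1.const_mul 2) hi2, intervalIntegral.integral_const_mul,
    integral_fejer_mul_cos_of_le (2 * m + 1) h1 hhi, integral_fejer_mul_cos_of_lt m (by omega)]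
  have hm : (0 : ℝ) < m + 1 := by positivity
  push_cast
  field_simp
  ring

/-- **The weights above the band**: `∫₀¹ V_m(x) cos(2πhx) dx = 0` for `h > 2m + 1`. [cite: Katznelson2004, I.2.13] -/
theorem integral_vp_mul_cos_of_lt (m : ℕ) {h : ℕ} (hh : 2 * m + 1 < h) :
    ∫ x in (0 : ℝ)..1, vp m x * Real.cos (2 * π * h * x) = 0 := by
  have hexp : ∀ x : ℝ, vp m x * Real.cos (2 * π * h * x) =
      2 * (fejer (2 * m + 1) x * Real.cos (2 * π * h * x)) - fejer m x * Real.cos (2 * π * h * x) := by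
    intro x; rw [vp]; ring
  simp_rw [hexp]
  have hi1 : IntervalIntegrable (fun x => fejer (2 * m + 1) x * Real.cos (2 * π * h * x)) volume 0 1 :=
    ((continuous_fejer _).mul (by fun_prop)).intervalIntegrable _ _
  have hi2 : IntervalIntegrable (fun x => fejer m x * Real.cos (2 * π * h * x)) volume 0 1 :=
    ((continuous_fejer _).mul (by fun_prop)).intervalIntegrable _ _
  rw [intervalIntegral.integral_sub (hi1.const_mul 2) hi2, intervalIntegral.integral_const_mul,
    integral_fejer_mul_cos_of_lt (2 * m + 1) hh, integral_fejer_mul_cos_of_lt m (by omega)]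
  ring

/-- The weights never exceed `1` in absolute value: `|∫₀¹ V_m cos(2πh·)| ≤ 1` for every `h ≥ 1`. [cite: Katznelson2004, I.2.13] -/
theorem abs_integral_vp_mul_cos_le (m : ℕ) {h : ℕ} (h1 : 1 ≤ h) :
    |∫ x in (0 : ℝ)..1, vp m x * Real.cos (2 * π * h * x)| ≤ 1 := by
  rcases Nat.lt_or_ge (2 * m + 1) h with hlt | hge
  · rw [integral_vp_mul_cos_of_lt m hlt, abs_zero]; exact zero_le_one
  · rcases Nat.lt_or_ge h (m + 1) with hlt' | hge'
    · rw [integral_vp_mul_cos_of_le m h1 hlt'.le, abs_one]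
    · rw [integral_vp_mul_cos_of_mem m hge' hge]
      have hm : (0 : ℝ) < m + 1 := by positivity
      have hlo : ((m : ℝ) + 1) ≤ h := by exact_mod_cast hge'
      have hhi : (h : ℝ) ≤ 2 * m + 1 := by exact_mod_cast hge
      have hr1 : 1 ≤ (h : ℝ) / (m + 1) := by rw [le_div_iff₀ hm]; linarith
      have hr2 : (h : ℝ) / (m + 1) ≤ 2 := by rw [div_le_iff₀ hm]; linarith
      rw [abs_le]
      constructor <;> linarith

end Literature.Analysis.Fourier.TrigApprox

end
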